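import Summits.CriticalPhenomena.PercolationContinuityZ3.Theorems.PercNearOneGluingNoHeavyLowerTailSahiSlotPairConeLifts

/-!
# The Kleitman diagonal `KD_A = 2^d·Dg(1_A;·,·) − Nf(1_A;·,·)` is in the pivotal-pair cone for EVERY up-set `A`, in every dimension

Support file of the one-cut programme (crux `NoHeavyLowerTail`, stmt-CriticalPhenomena-4575; cell `prim-masterthm`, seat P3, gen 25;
`run/shared/lean/prim/prim-masterthm/prim-masterthm-p3/HIERARCHY.md` §33, memo `FROM-prim-masterthm-p3-g25-SYMMETRIC-CENSUS-AND-SQKD.md` §3.1).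

The pinned form of an up-set `A ⊆ [3]^d` splits as `sStarD A = Σ_{p∈A} Latin(p) + KD_A` with the KLEITMAN DIAGONAL
`KD_A(B,C) = Σ_q c_A(q)·1_B(q)1_C(q)`, `c_A(q) = 2^d·1_A(q) − #{p ∈ A : p opposite q} = 2^d Dg(1_A;1_B,1_C) − Nf(1_A;1_B,1_C)` (typed atoms of
`…SahiSlotPairConeLifts`).  Gen 24 certified it only for the threshold `Θ` (`inPairCone_KD_thr`, an explicit two-level identity).  Here, for EVERY
up-set `A` and every `d`: `c_A(q) = harrisSlack d 1_A δ_q`, the Harris-slack certificate of gen 22 (`harrisSlack_eq_sum_litPairs`, valid for ALL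
real arguments) evaluated at `y = 1_A` has nonnegative coefficients `c_t·J_t(1_A)` (literals are nonnegative on up-sets), and the remaining
diagonal forms `(B,C) ↦ Σ_q J'(δ_q)·1_B(q)1_C(q)` of a single literal `J'` are `cover ⊗ point + point ⊗ cover` (`inPairCone_litDiag`).  Hence
**`inPairCone_KD`**: `InPairCone d (2^d·Dg(1_A;·,·) − Nf(1_A;·,·))` for every up-set `A` — one hypothesis fewer for every future lift identity, and
the diagonal half of the `SQKD` block `Sq_A + KD_A` of the memo.  Pure, standard axioms. [this work]
-/

noncomputable section

namespace Summit.CriticalPhenomena.PercolationContinuityZ3.Theorems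

open Finset Function
open Literature.Combinatorics.Sahi2008

namespace SahiSlot

open SahiGridPattern SahiGrid3

variable {d : ℕ}

/-- The point mass `δ_q` as a set indicator. [this work] -/
theorem setInd_singleton_apply (q x : Q d 3) : setInd ({q} : Finset (Q d 3)) x = if x = q then 1 else 0 := by
  unfold setInd
  simp only [mem_singleton]

/-- **Diagonal form of one literal**: `(B,C) ↦ Σ_q ℓ(δ_q)·1_B(q)·1_C(q)` is in the pair cone (`bot`: `δ_⊥⊗δ_⊥`; `top`: the points `≠ ⊤`;
a cut edge `p → p⁺`: `(1_B(p⁺) − 1_B(p))·1_C(p⁺) + 1_B(p)·(1_C(p⁺) − 1_C(p))`). [this work] -/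
theorem inPairCone_litDiag (ℓ : Lit d 3) :
    InPairCone d (fun B C => ∑ q, ℓ.eval (setInd ({q} : Finset (Q d 3))) * (setInd B q * setInd C q)) := by
  cases ℓ with
  | bot =>
    have h3 : (0:ℕ) < 3 := by norm_num
    refine (InPairCone.mul (InCone.point (d := d) (fun _ => ⟨0, h3⟩)) (InCone.point (fun _ => ⟨0, h3⟩))).congr fun B C _ _ => ?_
    have hev : ∀ q : Q d 3, (Lit.bot : Lit d 3).eval (setInd ({q} : Finset (Q d 3))) = if (fun _ => (⟨0, h3⟩ : Fin 3)) = q then 1 else 0 := by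
      intro q
      show (if h : 0 < 3 then setInd ({q} : Finset (Q d 3)) (fun _ => ⟨0, h⟩) else 0) = _
      rw [dif_pos h3, setInd_singleton_apply]
    simp_rw [hev]
    simp only [ite_mul, one_mul, zero_mul, Finset.sum_ite_eq, mem_univ, if_true]
  | top =>
    have h3 : (0:ℕ) < 3 := by norm_num
    set tp : Q d 3 := fun _ => ⟨3 - 1, Nat.sub_lt h3 Nat.one_pos⟩ with htp
    have hev : ∀ q : Q d 3, (Lit.top : Lit d 3).eval (setInd ({q} : Finset (Q d 3))) = 1 - (if tp = q then 1 else 0) := by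
      intro q
      show (if h : 0 < 3 then 1 - setInd ({q} : Finset (Q d 3)) (fun _ => ⟨3 - 1, Nat.sub_lt h Nat.one_pos⟩) else 0) = _
      rw [dif_pos h3, setInd_singleton_apply]
    have hw : ∀ q ∈ (univ : Finset (Q d 3)), (0:ℝ) ≤ 1 - (if tp = q then 1 else 0) := by
      intro q _; split_ifs <;> norm_num
    refine (InPairCone.sum_smul univ hw fun q _ => InPairCone.mul (InCone.point (d := d) q) (InCone.point q)).congr fun B C _ _ => ?_
    simp_rw [hev]
  | cover p a =>
    by_cases hp : (p a : ℕ) + 1 < 3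
    · set p1 : Q d 3 := update p a ⟨(p a : ℕ) + 1, hp⟩ with hp1
      have hev : ∀ q : Q d 3, (Lit.cover p a : Lit d 3).eval (setInd ({q} : Finset (Q d 3))) =
          (if p1 = q then 1 else 0) - (if p = q then 1 else 0) := by
        intro q
        show (if h : (p a : ℕ) + 1 < 3 then setInd ({q} : Finset (Q d 3)) (update p a ⟨(p a : ℕ) + 1, h⟩) - setInd ({q} : Finset (Q d 3)) p else 0) = _
        rw [dif_pos hp, setInd_singleton_apply, setInd_singleton_apply]
      have hst : InCone d (fun B => setInd B p1 - setInd B p) := by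
        have := InCone.step p a (p a) hp
        refine this.congr fun B _ => ?_
        rw [update_eq_self]
      refine ((InPairCone.mul hst (InCone.point p1)).add (InPairCone.mul (InCone.point p) hst)).congr fun B C _ _ => ?_
      simp_rw [hev]
      simp only [sub_mul, Finset.sum_sub_distrib, ite_mul, one_mul, zero_mul, Finset.sum_ite_eq, mem_univ, if_true]
      ring
    · refine InPairCone.zero.congr fun B C _ _ => ?_
      have hev : ∀ q : Q d 3, (Lit.cover p a : Lit d 3).eval (setInd ({q} : Finset (Q d 3))) = 0 := by
        intro q
        show (if h : (p a : ℕ) + 1 < 3 then setInd ({q} : Finset (Q d 3)) (update p a ⟨(p a : ℕ) + 1, h⟩) - setInd ({q} : Finset (Q d 3)) p else 0) = 0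
        rw [dif_neg hp]
      simp_rw [hev]
      simp

/-- **Diagonal forms weighted by the Harris slack of an up-set are in the pair cone**: `(B,C) ↦ Σ_q harrisSlack(1_A, δ_q)·1_B(q)1_C(q)`.
[this work] -/
theorem inPairCone_diag_harrisSlack (A : Finset (Q d 3)) (hA : IsUpperSet ((A : Finset (Q d 3)) : Set (Q d 3))) :
    InPairCone d (fun B C => ∑ q, harrisSlack d (setInd A) (setInd ({q} : Finset (Q d 3))) * (setInd B q * setInd C q)) := by
  obtain ⟨k, c, J, J', hc, hid⟩ := harrisSlack_eq_sum_litPairs d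
  have hw : ∀ t ∈ (univ : Finset (Fin k)), 0 ≤ c t * (J t).eval (setInd A) :=
    fun t _ => mul_nonneg (hc t) (Lit.eval_setInd_nonneg A hA _)
  refine (InPairCone.sum_smul univ hw fun t _ => inPairCone_litDiag (d := d) (J' t)).congr fun B C _ _ => ?_
  simp_rw [hid, Finset.sum_mul, Finset.mul_sum]
  rw [Finset.sum_comm]
  exact Finset.sum_congr rfl fun t _ => Finset.sum_congr rfl fun q _ => by ring

/-- The Harris slack against a point mass: `harrisSlack(1_A, δ_q) = 2^d·1_A(q) − #{x ∈ A : x opposite q}` (as a real sum). [this work] -/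
theorem harrisSlack_setInd_singleton (A : Finset (Q d 3)) (q : Q d 3) :
    harrisSlack d (setInd A) (setInd ({q} : Finset (Q d 3))) =
      (2:ℝ) ^ d * setInd A q - ∑ x, if (∀ a, x a ≠ q a) then setInd A x else 0 := by
  unfold harrisSlack
  have h1 : ∑ x, setInd A x * setInd ({q} : Finset (Q d 3)) x = setInd A q := by
    rw [Finset.sum_eq_single q]
    · rw [setInd_singleton_apply, if_pos rfl, mul_one]
    · intro x _ hx; rw [setInd_singleton_apply, if_neg hx, mul_zero]
    · intro h; exact absurd (mem_univ q) h
  have h2 : ∀ x : Q d 3, (∑ x', if (∀ a, x a ≠ x' a) then setInd A x * setInd ({q} : Finset (Q d 3)) x' else 0) =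
      if (∀ a, x a ≠ q a) then setInd A x else 0 := by
    intro x
    rw [Finset.sum_eq_single q]
    · rw [setInd_singleton_apply, if_pos rfl, mul_one]
    · intro x' _ hx'; rw [setInd_singleton_apply, if_neg hx', mul_zero, ite_self]
    · intro h; exact absurd (mem_univ q) h
  rw [h1]
  simp_rw [h2]

/-- Identification with the typed atoms: `2^d·Dg(1_A;1_B,1_C) − Nf(1_A;1_B,1_C) = Σ_q harrisSlack(1_A,δ_q)·1_B(q)1_C(q)`. [this work] -/
theorem cast_KD_eq_sum_harrisSlack (A B C : Finset (Q d 3)) :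
    (((2:ℤ) ^ d * Dg (ind A) (ind B) (ind C) - Nf (ind A) (ind B) (ind C) : ℤ) : ℝ) =
      ∑ q, harrisSlack d (setInd A) (setInd ({q} : Finset (Q d 3))) * (setInd B q * setInd C q) := by
  simp_rw [harrisSlack_setInd_singleton]
  unfold Dg Nf
  push_cast
  simp_rw [cast_ind]
  rw [Finset.mul_sum]
  have hN : ∑ p : Q d 3, ∑ q : Q d 3, setInd A p * setInd B q * setInd C q * (if TotDist p q = true then (1:ℝ) else 0) =
      ∑ q : Q d 3, (∑ x : Q d 3, if (∀ a, x a ≠ q a) then setInd A x else 0) * (setInd B q * setInd C q) := by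
    rw [Finset.sum_comm]
    refine Finset.sum_congr rfl fun q _ => ?_
    rw [Finset.sum_mul]
    refine Finset.sum_congr rfl fun x _ => ?_
    unfold TotDist
    by_cases h : ∀ a, x a ≠ q a
    · rw [if_pos h, if_pos (decide_eq_true h)]; ring
    · rw [if_neg h, if_neg (by simpa using h)]; ring
  rw [hN, ← Finset.sum_sub_distrib]
  exact Finset.sum_congr rfl fun q _ => by ring

/-- **The Kleitman diagonal of EVERY up-set is in the pivotal-pair cone** (every dimension). [this work] -/
theorem inPairCone_KD (A : Finset (Q d 3)) (hA : IsUpperSet ((A : Finset (Q d 3)) : Set (Q d 3))) :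
    InPairCone d (fun B C => (((2:ℤ) ^ d * Dg (ind A) (ind B) (ind C) - Nf (ind A) (ind B) (ind C) : ℤ) : ℝ)) :=
  (inPairCone_diag_harrisSlack A hA).congr fun B C _ _ => cast_KD_eq_sum_harrisSlack A B C

end SahiSlot

end Summit.CriticalPhenomena.PercolationContinuityZ3.Theorems
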